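import Mathlib.AlgebraicGeometry.Morphisms.QuasiSeparated
import Mathlib.AlgebraicGeometry.Morphisms.FinitePresentation
import Mathlib.AlgebraicGeometry.Gluing
import Mathlib.Topology.QuasiSeparated
import HarnessLib

/-!
# Pushouts of schemes along open immersions: points, finiteness, and an isomorphism criterion

Topic: `Literature/AlgebraicGeometry/Limits` (gluing of schemes; The Stacks project, Tags 01JA–01JD,
and the finiteness bookkeeping of EGA IV₁ §1 / Stacks 01KO for quasi-separatedness). For open
immersions `f : W → Z₁`, `g : W → Z₂` of schemes Mathlib constructs the pushout `Z₁ ⨿_W Z₂` as a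
locally directed colimit (`AlgebraicGeometry.Scheme.IsLocallyDirected`; the charts
`inl : Z₁ → Z₁ ⨿_W Z₂`, `inr` are open immersions and jointly surjective). This file records what
the descent of schemes along `Spec A_S = lim Spec A[1/s]` (`Limits/LocalizationTwoOpensDescent`,
built by gluing two descended charts) needs about such pushouts:

* `exists_eq_of_inl_eq_inr`, `range_inl_inter_range_inr`, `inl_preimage_range_inr`,
  `inr_preimage_range_inl` — the two charts meet exactly in `W`
  (Mathlib `Scheme.IsLocallyDirected.ι_eq_ι_iff`);
* `compactSpace_pushout`, `quasiSeparatedSpace_of_iSup_eq_top₂`, `quasiSeparatedSpace_pushout` —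
  `Z₁ ⨿_W Z₂` is quasi-compact if `Z₁, Z₂` are, and quasi-separated if `Z₁, Z₂` are and `W` is
  quasi-compact (Stacks 01KO (3): quasi-separatedness may be checked on one affine open cover,
  Mathlib `Scheme.quasiSeparatedSpace_of_isOpenCover`);
* `locallyOfFinitePresentation_pushoutDesc`, `quasiCompact_pushoutDesc`,
  `quasiSeparated_pushoutDesc` — the same for the structure morphism `Z₁ ⨿_W Z₂ → S` induced by
  compatible `Z₁ → S`, `Z₂ → S`;
* `isIso_morphismRestrict_of_preimage_eq`, `isIso_of_isIso_morphismRestrict` — a morphism which,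
  over the members of an open cover of the target, restricts to isomorphisms is an isomorphism
  (Mathlib: isomorphisms are Zariski-local at the target).

Everything is standard; no named facts.

## References

* The Stacks project, Tags 01JA–01JD (gluing schemes), 01KO (quasi-separatedness and affine open
  covers). [StacksProject]
* A. Grothendieck, EGA IV₃, §8.2 (where these finiteness conditions enter the limit formalism).
  [EGAIV3]
-/

noncomputable section

universe u

open CategoryTheory CategoryTheory.Limits AlgebraicGeometry TopologicalSpace Topology

namespace Literature.AlgebraicGeometry.Limits

/-! ## The two charts of a pushout along open immersions meet in `W` -/

section Charts

variable {W Z₁ Z₂ : Scheme.{u}} (f : W ⟶ Z₁) (g : W ⟶ Z₂) [IsOpenImmersion f] [IsOpenImmersion g]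

/-- The first chart `Z₁ → Z₁ ⨿_W Z₂` is an open immersion (Mathlib's instance for the legs of a
locally directed colimit, restated for `pushout.inl`, which instance search does not unfold).
[folklore] -/
theorem isOpenImmersion_inl : IsOpenImmersion (pushout.inl f g) :=
  Scheme.IsLocallyDirected.instIsOpenImmersionι (span f g) WalkingSpan.left

/-- The second chart `Z₂ → Z₁ ⨿_W Z₂` is an open immersion. [folklore] -/
theorem isOpenImmersion_inr : IsOpenImmersion (pushout.inr f g) :=
  Scheme.IsLocallyDirected.instIsOpenImmersionι (span f g) WalkingSpan.right

/-- In `Z₁ ⨿_W Z₂` (pushout of schemes along open immersions), a point of the chart `Z₁` equals a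
point of the chart `Z₂` only if both come from the same point of `W`
(Mathlib `Scheme.IsLocallyDirected.ι_eq_ι_iff` for the diagram `span f g`). [folklore] -/
theorem exists_eq_of_inl_eq_inr (y : Z₁) (z : Z₂) (h : pushout.inl f g y = pushout.inr f g z) :
    ∃ w : W, f w = y ∧ g w = z := by
  obtain ⟨k, fi, fj, x, hx, hy⟩ :=
    (Scheme.IsLocallyDirected.ι_eq_ι_iff (span f g) (i := WalkingSpan.left)
      (j := WalkingSpan.right) (xi := y) (xj := z)).mp h
  rcases k with (_ | _ | _)
  · obtain rfl : fi = WalkingSpan.Hom.fst := Subsingleton.elim _ _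
    obtain rfl : fj = WalkingSpan.Hom.snd := Subsingleton.elim _ _
    exact ⟨x, hx, hy⟩
  · cases fj
  · cases fi

/-- The two charts of `Z₁ ⨿_W Z₂` intersect exactly in the image of `W`. [folklore] -/
theorem range_inl_inter_range_inr :
    Set.range (pushout.inl f g) ∩ Set.range (pushout.inr f g) =
      Set.range (f ≫ pushout.inl f g) := by
  ext x
  constructor
  · rintro ⟨⟨y, rfl⟩, ⟨z, hz⟩⟩
    obtain ⟨w, rfl, rfl⟩ := exists_eq_of_inl_eq_inr f g y z hz.symm
    exact ⟨w, rfl⟩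
  · rintro ⟨w, rfl⟩
    refine ⟨⟨f w, rfl⟩, ⟨g w, ?_⟩⟩
    change (g ≫ pushout.inr f g) w = (f ≫ pushout.inl f g) w
    rw [pushout.condition]

/-- The part of the chart `Z₁` lying over the chart `Z₂` is `f(W)`. [folklore] -/
theorem inl_preimage_range_inr :
    pushout.inl f g ⁻¹' Set.range (pushout.inr f g) = Set.range f := by
  ext y
  constructor
  · rintro ⟨z, hz⟩
    obtain ⟨w, rfl, rfl⟩ := exists_eq_of_inl_eq_inr f g y z hz.symm
    exact ⟨w, rfl⟩
  · rintro ⟨w, rfl⟩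
    refine ⟨g w, ?_⟩
    change (g ≫ pushout.inr f g) w = (f ≫ pushout.inl f g) w
    rw [pushout.condition]

/-- The part of the chart `Z₂` lying over the chart `Z₁` is `g(W)`. [folklore] -/
theorem inr_preimage_range_inl :
    pushout.inr f g ⁻¹' Set.range (pushout.inl f g) = Set.range g := by
  ext z
  constructor
  · rintro ⟨y, hy⟩
    obtain ⟨w, rfl, rfl⟩ := exists_eq_of_inl_eq_inr f g y z hy
    exact ⟨w, rfl⟩
  · rintro ⟨w, rfl⟩
    refine ⟨f w, ?_⟩
    change (f ≫ pushout.inl f g) w = (g ≫ pushout.inr f g) w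
    rw [pushout.condition]

/-- Every point of `Z₁ ⨿_W Z₂` lies in one of the two charts. [folklore] -/
theorem range_inl_union_range_inr :
    Set.range (pushout.inl f g) ∪ Set.range (pushout.inr f g) = Set.univ := by
  refine Set.eq_univ_of_forall fun x => ?_
  obtain ⟨i, xi, rfl⟩ := Scheme.IsLocallyDirected.ι_jointly_surjective (span f g) x
  rcases i with (_ | _ | _)
  · left
    refine ⟨f xi, ?_⟩
    rw [← Scheme.Hom.comp_apply, ← colimit.w (span f g) WalkingSpan.Hom.fst]
    rfl
  · exact Or.inl ⟨xi, rfl⟩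
  · exact Or.inr ⟨xi, rfl⟩

/-- The open cover of `Z₁ ⨿_W Z₂` by its two charts has supremum `⊤`. [folklore] -/
theorem iSup_opensRange_inl_inr :
    (Scheme.Hom.opensRange (pushout.inl f g) (H := isOpenImmersion_inl f g)) ⊔
      (Scheme.Hom.opensRange (pushout.inr f g) (H := isOpenImmersion_inr f g)) = ⊤ := by
  apply Opens.ext
  simpa using range_inl_union_range_inr f g

/-! ## Quasi-compactness and quasi-separatedness of the pushout -/

/-- `Z₁ ⨿_W Z₂` is quasi-compact if `Z₁` and `Z₂` are. [folklore] -/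
theorem compactSpace_pushout [CompactSpace Z₁] [CompactSpace Z₂] : CompactSpace ↑(pushout f g) := by
  rw [← isCompact_univ_iff, ← range_inl_union_range_inr f g]
  exact (isCompact_range (pushout.inl f g).continuous).union
    (isCompact_range (pushout.inr f g).continuous)

/-- **Quasi-separatedness from a two-member open cover** (a case of Stacks 01KO (3)): if a scheme
is the union of two quasi-separated open subsets with quasi-compact intersection, it is
quasi-separated. Proof: the affine opens contained in one of the two members form an open cover
with pairwise quasi-compact intersections (Mathlib `Scheme.quasiSeparatedSpace_of_isOpenCover`):
for `U ⊆ Z₁`, `V ⊆ Z₂` affine, `U ∩ V = (U ∩ Z₁ ∩ Z₂) ∩ (V ∩ Z₁ ∩ Z₂)` is an intersection of two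
quasi-compact opens of `Z₁`. [cite: StacksProject, Tag 01KO] -/
theorem quasiSeparatedSpace_of_iSup_eq_top₂ {Z : Scheme.{u}} (Z₁ Z₂ : Z.Opens) (hZ : Z₁ ⊔ Z₂ = ⊤)
    (h₁ : IsQuasiSeparated (Z₁ : Set Z)) (h₂ : IsQuasiSeparated (Z₂ : Set Z))
    (h₁₂ : IsCompact ((Z₁ : Set Z) ∩ (Z₂ : Set Z))) : QuasiSeparatedSpace Z := by
  -- the affine opens inside `Z₁` or inside `Z₂`
  let I := {U : Z.affineOpens // (U : Z.Opens) ≤ Z₁ ∨ (U : Z.Opens) ≤ Z₂}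
  let c : I → Z.Opens := fun U => U.1
  have hc : IsOpenCover c := by
    rw [IsOpenCover, eq_top_iff]
    rintro x -
    have hx : x ∈ (Z₁ ⊔ Z₂ : Z.Opens) := by rw [hZ]; trivial
    rcases hx with hx | hx
    · obtain ⟨U, hUaff, hxU, hU⟩ := (Opens.isBasis_iff_nbhd.mp Z.isBasis_affineOpens) hx
      exact Opens.mem_iSup.mpr ⟨⟨⟨U, hUaff⟩, Or.inl hU⟩, hxU⟩
    · obtain ⟨U, hUaff, hxU, hU⟩ := (Opens.isBasis_iff_nbhd.mp Z.isBasis_affineOpens) hx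
      exact Opens.mem_iSup.mpr ⟨⟨⟨U, hUaff⟩, Or.inr hU⟩, hxU⟩
  -- mixed intersections
  have key : ∀ U V : Z.Opens, IsCompact (U : Set Z) → IsCompact (V : Set Z) → U ≤ Z₁ → V ≤ Z₂ →
      IsCompact ((U : Set Z) ∩ (V : Set Z)) := by
    intro U V hU hV hU₁ hV₂
    have e : ((U : Set Z) ∩ (V : Set Z)) =
        ((U : Set Z) ∩ ((Z₁ : Set Z) ∩ (Z₂ : Set Z))) ∩ ((V : Set Z) ∩ ((Z₁ : Set Z) ∩ (Z₂ : Set Z))) := by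
      ext x
      constructor
      · rintro ⟨hxU, hxV⟩
        exact ⟨⟨hxU, hU₁ hxU, hV₂ hxV⟩, hxV, hU₁ hxU, hV₂ hxV⟩
      · rintro ⟨⟨hxU, -⟩, hxV, -⟩
        exact ⟨hxU, hxV⟩
    rw [e]
    have o₁₂ : IsOpen ((Z₁ : Set Z) ∩ (Z₂ : Set Z)) := Z₁.2.inter Z₂.2
    have hU' : IsCompact ((U : Set Z) ∩ ((Z₁ : Set Z) ∩ (Z₂ : Set Z))) :=
      h₁ _ _ hU₁ U.2 hU Set.inter_subset_left o₁₂ h₁₂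
    have hV' : IsCompact ((V : Set Z) ∩ ((Z₁ : Set Z) ∩ (Z₂ : Set Z))) :=
      h₂ _ _ hV₂ V.2 hV Set.inter_subset_right o₁₂ h₁₂
    exact h₁ _ _ (Set.inter_subset_left.trans hU₁) (U.2.inter o₁₂) hU'
      (Set.inter_subset_right.trans Set.inter_subset_left) (V.2.inter o₁₂) hV'
  refine Scheme.quasiSeparatedSpace_of_isOpenCover c hc (fun U => U.1.2) fun U V => ?_
  rcases U with ⟨U, hU | hU⟩ <;> rcases V with ⟨V, hV | hV⟩
  · exact h₁ _ _ hU U.1.2 U.2.isCompact hV V.1.2 V.2.isCompact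
  · exact key U V U.2.isCompact V.2.isCompact hU hV
  · rw [Set.inter_comm]
    exact key V U V.2.isCompact U.2.isCompact hV hU
  · exact h₂ _ _ hU U.1.2 U.2.isCompact hV V.1.2 V.2.isCompact

/-- `Z₁ ⨿_W Z₂` is quasi-separated if `Z₁`, `Z₂` are quasi-separated and `W` is quasi-compact
(`quasiSeparatedSpace_of_iSup_eq_top₂` for the two charts, which meet in the image of `W`).
[cite: StacksProject, Tag 01KO] -/
theorem quasiSeparatedSpace_pushout [QuasiSeparatedSpace Z₁] [QuasiSeparatedSpace Z₂]
    [CompactSpace W] : QuasiSeparatedSpace ↑(pushout f g) := by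
  haveI := isOpenImmersion_inl f g
  haveI := isOpenImmersion_inr f g
  refine quasiSeparatedSpace_of_iSup_eq_top₂ (pushout.inl f g).opensRange
    (pushout.inr f g).opensRange (iSup_opensRange_inl_inr f g) ?_ ?_ ?_
  · change IsQuasiSeparated (Set.range (pushout.inl f g))
    rw [← Set.image_univ]
    exact (isQuasiSeparated_univ (α := Z₁)).image_of_isEmbedding
      (pushout.inl f g).isOpenEmbedding.isEmbedding
  · change IsQuasiSeparated (Set.range (pushout.inr f g))
    rw [← Set.image_univ]
    exact (isQuasiSeparated_univ (α := Z₂)).image_of_isEmbedding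
      (pushout.inr f g).isOpenEmbedding.isEmbedding
  · change IsCompact (Set.range (pushout.inl f g) ∩ Set.range (pushout.inr f g))
    rw [range_inl_inter_range_inr]
    exact isCompact_range (f ≫ pushout.inl f g).continuous

/-! ## The structure morphism of a pushout over a base -/

variable {S : Scheme.{u}} (p₁ : Z₁ ⟶ S) (p₂ : Z₂ ⟶ S) (w : f ≫ p₁ = g ≫ p₂)

/-- The two charts of `Z₁ ⨿_W Z₂`, as a `Bool`-indexed family of opens covering it. [folklore] -/
theorem iSup_cond_opensRange_eq_top :
    (⨆ b : Bool, cond b (Scheme.Hom.opensRange (pushout.inl f g) (H := isOpenImmersion_inl f g))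
      (Scheme.Hom.opensRange (pushout.inr f g) (H := isOpenImmersion_inr f g))) = ⊤ := by
  rw [iSup_bool_eq]
  exact iSup_opensRange_inl_inr f g

/-- A property of morphisms which is Zariski-local on the source and holds for `Z₁ → S` and
`Z₂ → S` holds for `Z₁ ⨿_W Z₂ → S`. [folklore] -/
theorem of_isZariskiLocalAtSource_pushoutDesc (P : MorphismProperty Scheme.{u})
    [IsZariskiLocalAtSource P] (h₁ : P p₁) (h₂ : P p₂) : P (pushout.desc p₁ p₂ w) := by
  haveI := isOpenImmersion_inl f g
  haveI := isOpenImmersion_inr f g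
  refine IsZariskiLocalAtSource.of_iSup_eq_top _ (iSup_cond_opensRange_eq_top f g) ?_
  rintro (_ | _)
  · change P ((pushout.inr f g).opensRange.ι ≫ pushout.desc p₁ p₂ w)
    rw [← Scheme.Hom.isoOpensRange_inv_comp, Category.assoc, pushout.inr_desc,
      P.cancel_left_of_respectsIso]
    exact h₂
  · change P ((pushout.inl f g).opensRange.ι ≫ pushout.desc p₁ p₂ w)
    rw [← Scheme.Hom.isoOpensRange_inv_comp, Category.assoc, pushout.inl_desc,
      P.cancel_left_of_respectsIso]
    exact h₁

/-- `Z₁ ⨿_W Z₂ → S` is locally of finite presentation if `Z₁ → S` and `Z₂ → S` are (local on the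
source). [folklore] -/
theorem locallyOfFinitePresentation_pushoutDesc [h₁ : LocallyOfFinitePresentation p₁]
    [h₂ : LocallyOfFinitePresentation p₂] : LocallyOfFinitePresentation (pushout.desc p₁ p₂ w) :=
  of_isZariskiLocalAtSource_pushoutDesc f g p₁ p₂ w @LocallyOfFinitePresentation h₁ h₂

/-- `Z₁ ⨿_W Z₂ → S` is locally of finite type if `Z₁ → S` and `Z₂ → S` are. [folklore] -/
theorem locallyOfFiniteType_pushoutDesc [h₁ : LocallyOfFiniteType p₁] [h₂ : LocallyOfFiniteType p₂] :
    LocallyOfFiniteType (pushout.desc p₁ p₂ w) :=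
  of_isZariskiLocalAtSource_pushoutDesc f g p₁ p₂ w @LocallyOfFiniteType h₁ h₂

/-- `Z₁ ⨿_W Z₂ → S` is quasi-compact if `Z₁`, `Z₂` are quasi-compact and `S` is quasi-compact and
quasi-separated (e.g. affine). [folklore] -/
theorem quasiCompact_pushoutDesc [CompactSpace Z₁] [CompactSpace Z₂] [CompactSpace S]
    [QuasiSeparatedSpace S] : QuasiCompact (pushout.desc p₁ p₂ w) := by
  rw [quasiCompact_iff_compactSpace]
  exact compactSpace_pushout f g

/-- `Z₁ ⨿_W Z₂ → S` is quasi-separated if `Z₁`, `Z₂` are quasi-separated, `W` is quasi-compact and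
`S` is quasi-separated (e.g. affine). [folklore] -/
theorem quasiSeparated_pushoutDesc [QuasiSeparatedSpace Z₁] [QuasiSeparatedSpace Z₂]
    [CompactSpace W] [QuasiSeparatedSpace S] : QuasiSeparated (pushout.desc p₁ p₂ w) := by
  rw [quasiSeparated_iff_quasiSeparatedSpace]
  exact quasiSeparatedSpace_pushout f g

end Charts

/-! ## Isomorphisms are local on the target -/

section IsoLocal

variable {Y Z : Scheme.{u}} (Φ : Y ⟶ Z)

/-- If `Φ⁻¹(O) = U` and `Φ|_U : U → O` is (induced by) an isomorphism `α`, then the restriction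
`Φ ∣_ O` is an isomorphism. [folklore] -/
theorem isIso_morphismRestrict_of_preimage_eq (U : Y.Opens) (O : Z.Opens) (α : (U : Scheme.{u}) ⟶ O)
    [IsIso α] (hα : U.ι ≫ Φ = α ≫ O.ι) (hU : Φ ⁻¹ᵁ O = U) : IsIso (Φ ∣_ O) := by
  have : Φ ∣_ O = (Y.isoOfEq hU).hom ≫ α := by
    rw [← cancel_mono O.ι, morphismRestrict_ι, Category.assoc, ← hα, ← Category.assoc,
      Scheme.isoOfEq_hom_ι]
  rw [this]
  infer_instance

/-- A morphism of schemes which restricts to an isomorphism over each member of an open cover of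
the target is an isomorphism (isomorphisms are Zariski-local on the target; Mathlib
`IsZariskiLocalAtTarget` for `MorphismProperty.isomorphisms`). [folklore] -/
theorem isIso_of_isIso_morphismRestrict {ι : Type*} (O : ι → Z.Opens) (hO : iSup O = ⊤)
    (h : ∀ i, IsIso (Φ ∣_ O i)) : IsIso Φ :=
  (IsZariskiLocalAtTarget.of_iSup_eq_top (P := MorphismProperty.isomorphisms Scheme.{u}) O hO
    fun i => (h i) : (MorphismProperty.isomorphisms Scheme.{u}) Φ)

end IsoLocal

end Literature.AlgebraicGeometry.Limits

end
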